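import Summits.AtomisticToContinuum.Crystallization.Theses.HullExactificationCascade
import Summits.AtomisticToContinuum.Crystallization.Theorems.HullExactificationCascadeHcpLandscapeGapOfTemplatedCoercivity

/-!
# Crux `HcpLandscapeGap` (stmt-AtomisticToContinuum-12087) — the statement T ("templated defect-counting
# coercivity at the relaxed-hcp box minimiser") that suffices for B, READY TO FILE (lead c4, 2026-08-17)

`TemplatedCoercivityAtMinimiser` (inline vocabulary, elaborates in the route file's context + `interactionEnergy`)
and `TemplatedCoercivityAtMinimiser'` (vocabulary of `HullExactificationCascadeRobustBarlowTemplateDefs`) are the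
same proposition definitionally (`Iff.rfl`), and either gives the crux through the LANDED glue
`HcpLandscapeGapBirth.HcpLandscapeGap_of_templatedCoercivity` (p155072).  It is implied by
`HcpBulkFloor ∧ HcpDefectCoercivity` (`HcpLandscapeGapBirth.templatedCoercivity_of_hcpDefectCounting`) and is what
B needs from the HcpDefectCounting side: stmt-14477 + stmt-14476 for injective enumerations of windows `S ∩ B̄_L(c)`
of admissible `S` only (δ-separated, everywhere `1/20`-good, Barlow-templated), with an `O((L+1)²)` allowance.
Informal: for `(a,h)` minimising `e_LJ(hcp a h)` over B's box and all `δ, θ > 0` there are `κ > 0`, `C` with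
`n·e_LJ(hcp a h) + κ·#{i : ¬Good_x(4,θ,i)} ≤ 𝓔_LJ(x) + C(L+1)²` for all such windows `x` (`Good_x(4,θ,i)` = the
radius-4 hcp chart predicate of stmt-14476 relative to the finite cluster `x`).  [difficulty: XL / open —
discrete nonlinear elastic + stacking stability of Lennard-Jones hcp inside the `1/20`-templated class]
-/

namespace Summit.AtomisticToContinuum.Crystallization.Cruxes.HcpLandscapeGap

/-- **T, inline form** (fileable as an item of route HullExactificationCascade as printed). -/
def TemplatedCoercivityAtMinimiser : Prop :=
  (∀ (a h : ℝ) (ha : a ≠ 0) (hh : h ≠ 0), (9 / 10 < a ∧ a < 1 ∧ |h - a * Real.sqrt (2 / 3)| ≤ a / 100) → (∀ a' h' : ℝ, ∀ ha' : a' ≠ 0, ∀ hh' : h' ≠ 0, (9 / 10 < a' ∧ a' < 1 ∧ |h' - a' * Real.sqrt (2 / 3)| ≤ a' / 100) → (Literature.MathematicalPhysics.StatisticalMechanics.hcpPeriodicConfiguration ha hh).energyPerParticle Literature.MathematicalPhysics.StatisticalMechanics.lennardJones ≤ (Literature.MathematicalPhysics.StatisticalMechanics.hcpPeriodicConfiguration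 ha' hh').energyPerParticle Literature.MathematicalPhysics.StatisticalMechanics.lennardJones) → (∀ δ θ : ℝ, 0 < δ → 0 < θ → ∃ κ : ℝ, 0 < κ ∧ ∃ C : ℝ, ∀ S : Set (EuclideanSpace ℝ (Fin 3)), (∀ y ∈ S, ∀ z ∈ S, y ≠ z → δ ≤ dist y z) → (∀ y ∈ S, (let d : ℝ := sInf ((fun z => dist z y) '' (S \ {y})); let T : Set (EuclideanSpace ℝ (Fin 3)) := {z : EuclideanSpace ℝ (Fin 3) | z ∈ S ∧ z ≠ y ∧ dist z y < 13 / 10 * d}; ∃ A : EuclideanSpace ℝ (Fin 3) →ₗᵢ[ℝ] EuclideanSpace ℝ (Fin 3), (∃ e : ↥T ≃ ↥Literature.Geometry.DiscreteGeometry.fccKissingPattern, ∀ t : ↥T, dist (d⁻¹ • ((t : EuclideanSpace ℝ (Fin 3)) - y)) (A ((e t : ↥Literature.Geometry.DiscreteGeometry.fccKissingPattern) : EuclideanSpace ℝ (Fin 3))) ≤ 1 / 20) ∨ (∃ e : ↥T ≃ ↥Literature.Geometry.DiscreteGeometry.hcpKissingPattern, ∀ t : ↥T, dist (d⁻¹ •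 ((t : EuclideanSpace ℝ (Fin 3)) - y)) (A ((e t : ↥Literature.Geometry.DiscreteGeometry.hcpKissingPattern) : EuclideanSpace ℝ (Fin 3))) ≤ 1 / 20))) → (∃ s : ℤ → ℤ, Literature.MathematicalPhysics.StatisticalMechanics.IsHaggSeq s ∧ ∃ Φ : EuclideanSpace ℝ (Fin 3) → EuclideanSpace ℝ (Fin 3), Set.BijOn Φ (Literature.MathematicalPhysics.StatisticalMechanics.barlowStacking 1 (Real.sqrt (2 / 3)) s) S ∧ ∀ p ∈ Literature.MathematicalPhysics.StatisticalMechanics.barlowStacking 1 (Real.sqrt (2 / 3)) s, ∃ A : EuclideanSpace ℝ (Fin 3) →ₗᵢ[ℝ] EuclideanSpace ℝ (Fin 3), ∃ l : ℝ, 0 < l ∧ ∀ q ∈ Literature.MathematicalPhysics.StatisticalMechanics.barlowStacking 1 (Real.sqrt (2 / 3)) s, dist q p ≤ 1 → dist (Φ q) (Φ p + l • A (q - p)) ≤ 1 / 20 * l) → ∀ (c : EuclideanSpace ℝ (Fin 3)) (L : ℝ), 0 ≤ L → ∀ (n : ℕ) (x : Fin n → EuclideanSpace ℝ (Fin 3)),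 Function.Injective x → Set.range x = {y : EuclideanSpace ℝ (Fin 3) | y ∈ S ∧ dist y c ≤ L} → (n : ℝ) * (Literature.MathematicalPhysics.StatisticalMechanics.hcpPeriodicConfiguration ha hh).energyPerParticle Literature.MathematicalPhysics.StatisticalMechanics.lennardJones + κ * (Nat.card {i : Fin n // ¬ (∃ A : EuclideanSpace ℝ (Fin 3) →ₗᵢ[ℝ] EuclideanSpace ℝ (Fin 3), (∀ p ∈ (Literature.MathematicalPhysics.StatisticalMechanics.hcpPeriodicConfiguration ha hh).points, ‖p‖ ≤ 4 → ∃ j : Fin n, dist (x j) (x i + A p) ≤ θ) ∧ (∀ j : Fin n, dist (x j) (x i) ≤ 4 → ∃ p ∈ (Literature.MathematicalPhysics.StatisticalMechanics.hcpPeriodicConfiguration ha hh).points, dist (x j) (x i + A p) ≤ θ))} : ℝ) ≤ Literature.MathematicalPhysics.StatisticalMechanics.interactionEnergy Literature.MathematicalPhysics.StatisticalMechanics.lennardJones x + C * (L + 1) ^ 2))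

/-- **T, named-vocabulary form** (`Sep`, `Good`, `idealStacking`, `LocSim` of
`HullExactificationCascadeRobustBarlowTemplateDefs`) — the registered stub `stub_templatedCoercivity` of
`Lines/birth.lean` (skeleton v5). -/
def TemplatedCoercivityAtMinimiser' : Prop :=
  (∀ (a h : ℝ) (ha : a ≠ 0) (hh : h ≠ 0), (9 / 10 < a ∧ a < 1 ∧ |h - a * Real.sqrt (2 / 3)| ≤ a / 100) → (∀ a' h' : ℝ, ∀ ha' : a' ≠ 0, ∀ hh' : h' ≠ 0, (9 / 10 < a' ∧ a' < 1 ∧ |h' - a' * Real.sqrt (2 / 3)| ≤ a' / 100) → (Literature.MathematicalPhysics.StatisticalMechanics.hcpPeriodicConfiguration ha hh).energyPerParticle Literature.MathematicalPhysics.StatisticalMechanics.lennardJones ≤ (Literature.MathematicalPhysics.StatisticalMechanics.hcpPeriodicConfiguration ha' hh').energyPerParticle Literature.MathematicalPhysics.StatisticalMechanics.lennardJones) → (∀ δ θ : ℝ, 0 < δ → 0 < θ → ∃ κ : ℝ, 0 < κ ∧ ∃ C : ℝ, ∀ S : Set (EuclideanSpace ℝ (Fin 3)), Summit.AtomisticToContinuum.Crystallization.Theorems.HullExactificationCascadeRobustBarlowTemplate.Sep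 δ S → (∀ y ∈ S, Summit.AtomisticToContinuum.Crystallization.Theorems.HullExactificationCascadeRobustBarlowTemplate.Good S y) → (∃ s : ℤ → ℤ, Literature.MathematicalPhysics.StatisticalMechanics.IsHaggSeq s ∧ ∃ Φ : EuclideanSpace ℝ (Fin 3) → EuclideanSpace ℝ (Fin 3), Set.BijOn Φ (Summit.AtomisticToContinuum.Crystallization.Theorems.HullExactificationCascadeRobustBarlowTemplate.idealStacking s) S ∧ Summit.AtomisticToContinuum.Crystallization.Theorems.HullExactificationCascadeRobustBarlowTemplate.LocSim s Φ) → ∀ (c : EuclideanSpace ℝ (Fin 3)) (L : ℝ), 0 ≤ L → ∀ (n : ℕ) (x : Fin n → EuclideanSpace ℝ (Fin 3)), Function.Injective x → Set.range x = {y : EuclideanSpace ℝ (Fin 3) | y ∈ S ∧ dist y c ≤ L} → (n : ℝ) * (Literature.MathematicalPhysics.StatisticalMechanics.hcpPeriodicConfiguration ha hh).energyPerParticle Literature.MathematicalPhysics.StatisticalMechanics.lennardJones + κ * (Nat.card {i : Fin n // ¬ (∃ A : EuclideanSpace ℝ (Fin 3) →ₗᵢ[ℝ] EuclideanSpace ℝ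 (Fin 3), (∀ p ∈ (Literature.MathematicalPhysics.StatisticalMechanics.hcpPeriodicConfiguration ha hh).points, ‖p‖ ≤ 4 → ∃ j : Fin n, dist (x j) (x i + A p) ≤ θ) ∧ (∀ j : Fin n, dist (x j) (x i) ≤ 4 → ∃ p ∈ (Literature.MathematicalPhysics.StatisticalMechanics.hcpPeriodicConfiguration ha hh).points, dist (x j) (x i + A p) ≤ θ))} : ℝ) ≤ Literature.MathematicalPhysics.StatisticalMechanics.interactionEnergy Literature.MathematicalPhysics.StatisticalMechanics.lennardJones x + C * (L + 1) ^ 2))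

/-- The two forms agree definitionally. -/
theorem templatedCoercivityAtMinimiser_iff :
    TemplatedCoercivityAtMinimiser ↔ TemplatedCoercivityAtMinimiser' := Iff.rfl

/-- **T suffices for the crux** (landed glue p155072). -/
theorem hcpLandscapeGap_of_T (hT : TemplatedCoercivityAtMinimiser) :
    Summit.AtomisticToContinuum.Crystallization.Theses.HullExactificationCascade.HcpLandscapeGap :=
  Summit.AtomisticToContinuum.Crystallization.Theorems.HcpLandscapeGapBirth.HcpLandscapeGap_of_templatedCoercivityInline hT

/-- **T is weaker than the sibling cruxes** (landed, p155072). -/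
theorem T_of_hcpDefectCounting
    (hF : Summit.AtomisticToContinuum.Crystallization.Theses.HcpDefectCounting.HcpBulkFloor)
    (hK : Summit.AtomisticToContinuum.Crystallization.Theses.HcpDefectCounting.HcpDefectCoercivity) :
    TemplatedCoercivityAtMinimiser :=
  Summit.AtomisticToContinuum.Crystallization.Theorems.HcpLandscapeGapBirth.templatedCoercivity_of_hcpDefectCounting hF hK

end Summit.AtomisticToContinuum.Crystallization.Cruxes.HcpLandscapeGap
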